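/-
Copyright (c) 2026 the pub-hodgecm-mathlib formalisation cell (harness21).  Prover seat hodgecm-mathlib-LH7-p08 (g3), req620 Track A «(D-RAM) FOUR-FRAME» squad
(STAGE-1b, row (2) of the piece `f_{T₊}`, the (β₂) road (R-36) «PURE-CELL LEDGER», K6 road; the DRESS of ★ p864600 (Q1b) in the (d″-T) digit currency of ★ p864509, so that
★ p864447's density letters `hL0 ∕ hLNear` are instantiated BY NAME), 2026-09-05.
-/
import Summits.HodgeConjecture.HodgeConjecture.Theorems.F0P3cDyRamRowCellDigitClassBalance   -- ★ p864600 (this seat): Q1b balance counts; brings ★ p864536 twist, ★ p864480, ★ p864361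
import Summits.HodgeConjecture.HodgeConjecture.Theorems.F0P3cDyRamOneChartDigitTotals        -- ★ p864509 (LH7-p06 (g3)): (d″-T) shell ∕ ball totals `card_filter_shell_eq_mul_card_ball`
import HarnessLib

/-!
# Crux `H413`, line LH4 «(D-RAM) FOUR-FRAME» — STAGE-1b, row (2), the (β₂) road (R-36), K6-(d″-Q) DRESS: «THE BALANCE COUNTS IN THE DIGIT-TOTAL CURRENCY» — the sphere filters
# `max 1 (|V|·|ξ₀|) = R` of ★ p864600 ARE the level ∕ ball filters `|V| = |ϖ|^{2(N−i)}` ∕ `|V| ≤ |ϖ|^{2N}` of ★ p864509 in the chart `|ξ₀| = exp 2N`, and the balance HEAD reads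
# `2·#(diagonal CLASS_c digits) = β`, `2·#(cell-i CLASS_c digits) = (q−1)·q^{i−1}·β` (`1 ≤ i ≤ d − 2`) — ★ p864447's `hL0`, `hLNear` for both literals

Cell `hodgecm-mathlib` (D-0151), FLOOR 0, crux item H413 = `stmt-HodgeConjecture-24833`, route of record `HCCMUnconditional`; squad F0∕P3c∕LH7 (hand lent to the LH4 β₂ board);
lane `--supports stmt-HodgeConjecture-24833 --as helper` (count-neutral; pays NO tier-0 row).  THEOREMS ONLY (no `def`, no instance, no notation, no `sorry`, default heartbeats);
★-only imports; states NO law; (β₂) stays a HYPOTHESIS.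

WHAT.  §1 `filter_sphere_one_eq_filter_ball` (`R = 1` ↔ the ball `|V| ≤ |ϖ|^{2N}`), `filter_sphere_eq_filter_level` (`R = exp 2i`, `1 ≤ i ≤ N` ↔ the level `|V| = |ϖ|^{2(N−i)}`) — pure
valuation arithmetic at `|ξ₀| = exp 2N`, `|ϖ| = exp(−1)`.  §2 HEADS `two_mul_card_filter_class_ball_eq` (`2·#((Rd.filter ball).filter CLASS_c) = #(Rd.filter ball)`) and
`two_mul_card_filter_class_level_eq` (`2·#((Rd.filter level_{N−i}).filter CLASS_c) = (q−1)·q^{i−1}·#(Rd.filter ball)`, `1 ≤ i ≤ d − 2`, `i ≤ N`) — ★ p864600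
`two_mul_card_filter_class_eq_card` at `R := 1 ∕ exp 2i` + §1 + ★ p864509 `card_filter_shell_eq_mul_card_ball`; the digit resolution `r = |ϖ|^n` must satisfy the ONE floor
`2N + 2d − 1 ≤ n` (finer than the class on the diagonal ball: `r·|ξ₀| ≤ |ϖ|^{2d−1}`); `2 ≤ d`, `|2| < 1`; `c` = `hρh` or `h′ρh′` (both literals).
WHAT IS NOT CLAIMED: the boundary shell (★∕LH4-p11 (g11) Q2), the far shells beyond ★ p864600 §2, any census identity.
HONEST LABEL.  Count-neutral bookkeeping; nothing printed is asserted; no census law is stated; `HC_CM` is proved only modulo the 7 printed citations (2 remaining named inputs: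
hLiu418 = `stmt-HodgeConjecture-24832`, h413 = `stmt-HodgeConjecture-24833`) until rung 0 closes.
## References
* [Serre1979] J.-P. Serre, *Local Fields*, GTM 67 (1979): Ch. II §4 Prop. 5 p. 32 (representatives), Ch. V §3 Prop. 5, Cor. 2–3 pp. 84–86, Ch. XV §2.
* [LabesseLanglands1979] J.-P. Labesse, R. P. Langlands, *L-indistinguishability for SL(2)*, Canad. J. Math. 31 (1979): §2 (2.2) p. 9 (κ-signed counts).
* [Flicker1998UnitaryFL] Y. Z. Flicker, *Elementary proof of the fundamental lemma for a unitary group*, Canad. J. Math. 50 (1998): Prop. 7 p. 84 (type RamK census by classes).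
-/

set_option autoImplicit false

noncomputable section

namespace Summit.HodgeConjecture.HodgeConjecture.Cruxes.H413.F0P3cDyRamRowCellDigitClassBalanceDress

open scoped Valued WithZero
open WithZero Finset
open Literature.NumberTheory.Automorphic.UnitaryThreeFourFrame (IsRamifiedQuadraticDatum)
open Summit.HodgeConjecture.HodgeConjecture.Cruxes.H413.F0P3cDyRamRowCellDigitClassBalance (two_mul_card_filter_class_eq_card)
open Summit.HodgeConjecture.HodgeConjecture.Cruxes.H413.F0P3cDyRamOneChartDigitTotals (card_filter_shell_eq_mul_card_ball)

variable {E M : Type} [Field E] [Valued E ℤᵐ⁰] [Field M] [Valued M ℤᵐ⁰] {ρ Θ : M →+* M} {α : M}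

/-! ## §1 The sphere filters of the one chart are the level ∕ ball filters -/

/-- **`R = 1` IS THE BALL `|V| ≤ |ϖ|^{2N}`** in the chart `|ξ₀| = exp 2N` (`|ϖ| = exp(−1)`): the two digit filters coincide. [cite: Serre1979, Ch. II §4 Prop. 5 p. 32] -/
theorem filter_sphere_one_eq_filter_ball {ϖ : E} (hϖ : Valued.v ϖ = exp (-1 : ℤ)) {ξ₀ : M} {N : ℕ} (hξN : Valued.v ξ₀ = exp (2 * (N : ℤ)))
    (Rd : Finset E) :
    (Rd.filter fun V => max 1 (Valued.v V * Valued.v ξ₀) = 1) = Rd.filter fun V => Valued.v V ≤ Valued.v ϖ ^ (2 * N) := by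
  refine Finset.filter_congr fun V _ => ?_
  rw [max_eq_left_iff, hξN, hϖ, ← exp_nsmul, nsmul_eq_mul, ← le_div_iff₀ exp_pos, one_div, ← exp_neg]
  constructor <;> intro h <;> (refine h.trans_eq ?_; congr 1; push_cast; ring)

/-- **`R = exp 2i` IS THE LEVEL `|V| = |ϖ|^{2(N − i)}`** (`1 ≤ i ≤ N`) in the chart `|ξ₀| = exp 2N`: the two digit filters coincide. [cite: Serre1979, Ch. II §4 Prop. 5 p. 32] -/
theorem filter_sphere_eq_filter_level {ϖ : E} (hϖ : Valued.v ϖ = exp (-1 : ℤ)) {ξ₀ : M} {N : ℕ} (hξN : Valued.v ξ₀ = exp (2 * (N : ℤ)))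
    {i : ℕ} (hi1 : 1 ≤ i) (hiN : i ≤ N) (Rd : Finset E) :
    (Rd.filter fun V => max 1 (Valued.v V * Valued.v ξ₀) = exp (2 * (i : ℤ))) = Rd.filter fun V => Valued.v V = Valued.v ϖ ^ (2 * (N - i)) := by
  refine Finset.filter_congr fun V _ => ?_
  have hgt : (1 : ℤᵐ⁰) < exp (2 * (i : ℤ)) := by rw [← exp_zero, exp_lt_exp]; omega
  have hlevel : Valued.v ϖ ^ (2 * (N - i)) = exp (2 * (i : ℤ)) / exp (2 * (N : ℤ)) := by
    rw [hϖ, ← exp_nsmul, nsmul_eq_mul, ← exp_sub]; congr 1; push_cast; omega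
  rw [hlevel, eq_div_iff exp_ne_zero, ← hξN]
  constructor
  · intro h
    rcases le_total 1 (Valued.v V * Valued.v ξ₀) with hle | hle
    · rwa [max_eq_right hle] at h
    · rw [max_eq_left hle] at h; exact absurd h hgt.ne
  · intro h; rw [h, max_eq_right hgt.le]

/-! ## §2 HEADS — `hL0` and `hLNear` in the digit-total currency -/

/-- **`hL0` — THE DIAGONAL BALL IS BALANCED: `2·#((Rd.filter (|·| ≤ |ϖ|^{2N})).filter CLASS_c) = #(Rd.filter (|·| ≤ |ϖ|^{2N}))`.**  Frame: the ONE chart of ★ p864600's HEAD with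
`|ξ₀| = exp 2N` (`κ₀` of `ρ`-trace one, `Θ`-fixed, `|κ₀| = 1`; `ξ₀` `ρ`-anti, `Θ`-fixed), a doubly-fixed scalar `c ≠ 0` (`hρh` or `h′ρh′`), the (d″-T) digit system `Rd` mod `|ϖ|^n`
with the ONE resolution floor `2N + 2d − 1 ≤ n`; `2 ≤ d`, `|2| < 1`. [cite: LabesseLanglands1979, §2 (2.2) p. 9] [cite: Serre1979, Ch. V §3 Prop. 5, Cor. 2–3 pp. 84–86] [cite: Flicker1998UnitaryFL, Prop. 7 p. 84] -/
theorem two_mul_card_filter_class_ball_eq [CompleteSpace E] [Finite 𝓀[E]] {σ : E →+* E} {ϖ : E} {d tE : ℕ}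
    (hD : IsRamifiedQuadraticDatum σ ϖ d tE) (h2v : Valued.v (2 : E) < 1) (hd2 : 2 ≤ d)
    (jE : E →+* M) (hjfix : ∀ z, ρ z = z ↔ ∃ c, jE c = z) (hΘj : ∀ c, Θ (jE c) = jE (σ c)) (hjiso : ∀ a, Valued.v (jE a) = Valued.v a)
    (hρρ : ∀ x, ρ (ρ x) = x) (hvρ : ∀ x, Valued.v (ρ x) = Valued.v x) (hΘρ : ∀ x, Θ (ρ x) = ρ (Θ x))
    {κ₀ ξ₀ : M} (hκ₀ : κ₀ + ρ κ₀ = 1) (hΘκ₀ : Θ κ₀ = κ₀) (hκ₀1 : Valued.v κ₀ = 1) (hξ : ρ ξ₀ = -ξ₀) (hΘξ : Θ ξ₀ = ξ₀)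
    {N : ℕ} (hξN : Valued.v ξ₀ = exp (2 * (N : ℤ)))
    {c : M} (hρc : ρ c = c) (hΘc : Θ c = c) (hc : c ≠ 0)
    (Rd : Finset E) {n : ℕ} (hRd1 : ∀ V ∈ Rd, σ V = V ∧ Valued.v V ≤ 1)
    (hRd2 : ∀ V : E, σ V = V → Valued.v V ≤ 1 → ∃ V₀ ∈ Rd, Valued.v (V - V₀) ≤ Valued.v ϖ ^ n)
    (hRd3 : ∀ V ∈ Rd, ∀ V' ∈ Rd, Valued.v (V - V') ≤ Valued.v ϖ ^ n → V = V') (hn : 2 * N + (2 * d - 1) ≤ n)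
    [DecidablePred fun V : E => ∃ e : M, ρ e = e ∧ e * Θ e = (κ₀ + jE V * ξ₀) * ρ (κ₀ + jE V * ξ₀) / c] :
    2 * ((Rd.filter fun V => Valued.v V ≤ Valued.v ϖ ^ (2 * N)).filter
        fun V => ∃ e : M, ρ e = e ∧ e * Θ e = (κ₀ + jE V * ξ₀) * ρ (κ₀ + jE V * ξ₀) / c).card =
      (Rd.filter fun V => Valued.v V ≤ Valued.v ϖ ^ (2 * N)).card := by
  obtain ⟨-, -, hϖ, -, -, hd1, -⟩ := id hD
  have hϖpow : ∀ k : ℕ, Valued.v ϖ ^ k = exp (-(k : ℤ)) := fun k => by rw [hϖ, ← exp_nsmul, nsmul_eq_mul, mul_neg, mul_one]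
  have hξ0 : ξ₀ ≠ 0 := fun h0 => by rw [h0, Valuation.map_zero] at hξN; exact exp_ne_zero hξN.symm
  rw [← filter_sphere_one_eq_filter_ball hϖ hξN Rd]
  refine two_mul_card_filter_class_eq_card hD h2v hd2 jE hjfix hΘj hjiso hρρ hvρ hΘρ hκ₀ hΘκ₀ hκ₀1 hξ hΘξ hξ0 hρc hΘc hc Rd hRd1 hRd2 hRd3
    le_rfl ?_ ?_ ?_ ?_
  · rw [hξN, ← exp_zero, exp_le_exp]; omega
  · rw [one_mul, hϖpow, ← exp_zero, exp_lt_exp]; omega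
  · rw [hϖpow, hξN, ← exp_add, ← exp_zero, exp_lt_exp]; omega
  · rw [hϖpow, hϖpow, hξN, ← exp_add, mul_one, exp_le_exp]; omega

/-- **`hLNear` — AN INNER CELL IS BALANCED: `2·#((Rd.filter (|·| = |ϖ|^{2(N−i)})).filter CLASS_c) = (q − 1)·q^{i−1}·#(Rd.filter (|·| ≤ |ϖ|^{2N}))`** for `1 ≤ i ≤ d − 2`, `i ≤ N`
(frame of `two_mul_card_filter_class_ball_eq`; ★ p864509 `card_filter_shell_eq_mul_card_ball` supplies the shell total).
[cite: LabesseLanglands1979, §2 (2.2) p. 9] [cite: Serre1979, Ch. II §4 Prop. 5 p. 32; Ch. V §3 Prop. 5, Cor. 2–3 pp. 84–86] [cite: Flicker1998UnitaryFL, Prop. 7 p. 84] -/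
theorem two_mul_card_filter_class_level_eq [CompleteSpace E] [Finite 𝓀[E]] {σ : E →+* E} {ϖ : E} {d tE : ℕ}
    (hD : IsRamifiedQuadraticDatum σ ϖ d tE) (h2v : Valued.v (2 : E) < 1) (hd2 : 2 ≤ d)
    (jE : E →+* M) (hjfix : ∀ z, ρ z = z ↔ ∃ c, jE c = z) (hΘj : ∀ c, Θ (jE c) = jE (σ c)) (hjiso : ∀ a, Valued.v (jE a) = Valued.v a)
    (hρρ : ∀ x, ρ (ρ x) = x) (hvρ : ∀ x, Valued.v (ρ x) = Valued.v x) (hΘρ : ∀ x, Θ (ρ x) = ρ (Θ x))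
    {κ₀ ξ₀ : M} (hκ₀ : κ₀ + ρ κ₀ = 1) (hΘκ₀ : Θ κ₀ = κ₀) (hκ₀1 : Valued.v κ₀ = 1) (hξ : ρ ξ₀ = -ξ₀) (hΘξ : Θ ξ₀ = ξ₀)
    {N : ℕ} (hξN : Valued.v ξ₀ = exp (2 * (N : ℤ)))
    {c : M} (hρc : ρ c = c) (hΘc : Θ c = c) (hc : c ≠ 0)
    (Rd : Finset E) {n : ℕ} (hRd1 : ∀ V ∈ Rd, σ V = V ∧ Valued.v V ≤ 1)
    (hRd2 : ∀ V : E, σ V = V → Valued.v V ≤ 1 → ∃ V₀ ∈ Rd, Valued.v (V - V₀) ≤ Valued.v ϖ ^ n)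
    (hRd3 : ∀ V ∈ Rd, ∀ V' ∈ Rd, Valued.v (V - V') ≤ Valued.v ϖ ^ n → V = V') (hn : 2 * N + (2 * d - 1) ≤ n)
    {i : ℕ} (hi1 : 1 ≤ i) (hid : i + 2 ≤ d) (hiN : i ≤ N)
    [DecidablePred fun V : E => ∃ e : M, ρ e = e ∧ e * Θ e = (κ₀ + jE V * ξ₀) * ρ (κ₀ + jE V * ξ₀) / c] :
    2 * ((Rd.filter fun V => Valued.v V = Valued.v ϖ ^ (2 * (N - i))).filter
        fun V => ∃ e : M, ρ e = e ∧ e * Θ e = (κ₀ + jE V * ξ₀) * ρ (κ₀ + jE V * ξ₀) / c).card =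
      (Nat.card 𝓀[E] - 1) * Nat.card 𝓀[E] ^ (i - 1) * (Rd.filter fun V => Valued.v V ≤ Valued.v ϖ ^ (2 * N)).card := by
  obtain ⟨-, -, hϖ, -, -, hd1, -⟩ := id hD
  have hϖpow : ∀ k : ℕ, Valued.v ϖ ^ k = exp (-(k : ℤ)) := fun k => by rw [hϖ, ← exp_nsmul, nsmul_eq_mul, mul_neg, mul_one]
  have hξ0 : ξ₀ ≠ 0 := fun h0 => by rw [h0, Valuation.map_zero] at hξN; exact exp_ne_zero hξN.symm
  rw [← card_filter_shell_eq_mul_card_ball hD Rd hRd1 hRd2 hRd3 (by omega) i hi1 hiN, ← filter_sphere_eq_filter_level hϖ hξN hi1 hiN Rd]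
  refine two_mul_card_filter_class_eq_card hD h2v hd2 jE hjfix hΘj hjiso hρρ hvρ hΘρ hκ₀ hΘκ₀ hκ₀1 hξ hΘξ hξ0 hρc hΘc hc Rd hRd1 hRd2 hRd3
    ?_ ?_ ?_ ?_ ?_
  · rw [← exp_zero, exp_le_exp]; omega
  · rw [hξN, exp_le_exp]; omega
  · rw [hϖpow, ← exp_add, ← exp_zero, exp_lt_exp]; omega
  · rw [hϖpow, hξN, ← exp_add, exp_lt_exp]; omega
  · rw [hϖpow, hϖpow, hξN, ← exp_add, ← exp_add, exp_le_exp]; omega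

end Summit.HodgeConjecture.HodgeConjecture.Cruxes.H413.F0P3cDyRamRowCellDigitClassBalanceDress

end
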